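import Summits.Langlands.Langlands.Theses.AbelianSurfaceSerre
import Literature.NumberTheory.Automorphic.CaraianiNewtonModularity
import Literature.NumberTheory.EllipticCurves.FramedTateGaloisRep
import HarnessLib

/-!
# Sketch — crux ideas for `AbelianSurfaceSerre.SurfaceSectorComplement` (stmt-Langlands-17767),
# crux-ideate round 1, ideator 1 (planner-cruxidea-stmt-Langlands-17767-1-0, 2026-08-17)

`S := SurfaceSectorComplement := EndTrivialSurfacesModular → _root_.Langlands` is the route's FRAME item
(X := `EndTrivialSurfacesModular`, the route target: every abelian surface `A/ℚ` with `End_ℚ A = ℤ` is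
weakly modular on `GL₄/ℚ`).  Refuter certificate (W.lean on the item): `S ↔ ¬X ∨ Langlands`,
`Langlands → S`, `¬S ↔ X ∧ ¬Langlands`; modulo Faltings + geometricity `Langlands ↔ X ∧ S`.
The only non-costume content a line on `S` can carry is a typed REGION of the summit's certified
partition `W → B_w → LGC → JS (2.2) → JS (2.3) → Langlands`
(`Cruxes/SectorToLanglands/Lines/SectorToLanglandsOfLeaves.lean`) that X discharges OUTSIDE its own sector,
with the transport proved or theorem-grade.  This file types two such transports:

* §2 **Burkhardt anchor** (card `burkhardt-anchor`): X is the missing "Langlands–Tunnell" of `GSp₄` at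
  `p = 3` — by Boxer–Calegari–Gee–Pilloni 2021 §10.2 (Thm. 10.2.1 + Lemma 10.2.4: for EVERY
  `ρ̄ : Γ_ℚ → GSp₄(𝔽₃)` with similitude `ε̄⁻¹` the moduli space `P(ρ̄)` is RATIONAL over `ℚ`, hence
  `ρ̄ ≅ A[3]^∨ ⊗ 𝔽̄₃`-dually for infinitely many abelian surfaces `A/ℚ` with `End_ℂ A = ℤ`), X makes every
  such `ρ̄` residually modular: `serreModThree_of_X` (PROVED below, pure plumbing).
* §3 **Weil-restriction descent** (card `weil-restriction-descent`): X exits its sector DOWN the cyclic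
  automorphic induction `GL₂/K ⇝ GL₄/ℚ` for every quadratic field `K`: the `η_K`-self-twisted `Π` that X
  attaches to `Res_{K/ℚ} E` de-induces (Arthur–Clozel III Thm. 4.2/Lemma 6.6) to a cuspidal `π` on
  `GL₂(𝔸_K)` matching `ρ_{E,p}` a.e. (BCGP 2021 Thm. 9.3.x pattern, there for potential modularity):
  `regionB_of_X`, `ellipticOverQuadratic_of_X` (PROVED below modulo three named packages).

Nothing here asserts `S`, `X`, `Langlands` or a refuted statement; every `def … : Prop` with a paper
behind it is a named-fact SHAPE used as a hypothesis.  No `sorry`.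

References: BoxerCalegariGeePilloni2021 = arXiv:1812.09269 (§2.7 Prop. 2.7.x/Rem. 2.7.2, §8.4
Thm. 8.4.1, §9.3 "genus one curves", §10.2 Thm. 10.2.1/Lemma 10.2.4); BoxerCalegariGeePilloni2025 =
arXiv:2502.20645 (§1.2, Def. 9.2.1); ArthurClozelAMS120 (Ch. 3 Thm. 4.2, Thm. 6.2, Lemmas 6.4–6.6);
CaraianiNewton2023 (arXiv:2301.10509, Thm. 1.1); HarrisLanTaylorThorneRMS2016 / Scholze2015 (Galois
representations for regular algebraic `π` over CM fields); ShepherdBarronTaylor1997 (the `GL₂(𝔽₄)`,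
`GL₂(𝔽₅)` prototype of the Burkhardt realisation).
-/

noncomputable section

set_option linter.dupNamespace false

open scoped NumberField MatrixGroups Matrix Classical Polynomial
open NumberField IsDedekindDomain Filter Polynomial
open Literature.NumberTheory.Automorphic Literature.NumberTheory.GaloisRepresentations
open Summit.Langlands
open Summit.Langlands.Langlands.Theses.AbelianSurfaceSerre

namespace Summit.Langlands.Langlands.Cruxes.SurfaceSectorComplement.IdeasR1K1

/-! ## §0 Probes: the statement shape served today, and the logical position of `S` -/

/-- The summit as served (re-type p141787: `Nonempty (ReciprocityData F) ∧ ∀ 𝓡 …`). [folklore] -/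
example : _root_.Langlands ↔
    ∀ (F : Type) [Field F] [NumberField F],
      Nonempty (ReciprocityData F) ∧
        ∀ (𝓡 : ReciprocityData F) (n : ℕ), 0 < n →
          ∀ hcpt : isCompact_glFiniteIntegralLevel n F, GlobalLanglandsCorrespondenceGLn n F 𝓡 hcpt :=
  Iff.rfl

/-- `S` is by definition `X → Langlands`; the summit gives it for free. [folklore] -/
example : _root_.Langlands → SurfaceSectorComplement := fun h _ => h

/-! ## §1 Shared vocabulary: the clauses of the route file, named -/

/-- `A/ℚ` is an abelian SURFACE with `End_ℚ(A) = ℤ` (the two leading binders of the route target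
`EndTrivialSurfacesModular`, verbatim). [folklore] -/
def IsEndTrivialSurface (A : Literature.AlgebraicGeometry.Motives.AbelianVariety ℚ) : Prop :=
  A.dim = 2 ∧ ∀ f : A ⟶ A, ∃ n : ℤ, f = n • CategoryTheory.CategoryStruct.id A

/-- `r : Γ_ℚ → GL₄(ℚ̄_p)` is the framing, in the basis `b`, of `H¹_ét(A_ℚ̄, ℚ_p) ⊗ ℚ̄_p = (V_p A)^∨ ⊗ ℚ̄_p`
(the target's framing clause, verbatim). [folklore] -/
def IsH1Framing (A : Literature.AlgebraicGeometry.Motives.AbelianVariety ℚ) (p : ℕ) [Fact p.Prime]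
    (b : Module.Basis (Fin 4) ℚ_[p] (A.rationalTateModule p))
    (r : FramedGaloisRep ℚ (PadicAlgCl p) 4) : Prop :=
  ∀ g : Field.absoluteGaloisGroup ℚ,
    (r g).val = ((LinearMap.toMatrix b b (A.rationalTateRep p g⁻¹)).map
      (algebraMap ℚ_[p] (PadicAlgCl p))).transpose

/-- **Weak modularity of a framed `r : Γ_ℚ → GL₄(ℚ̄_p)`** (the target's conclusion, verbatim): for every
compactness witness and every `ι` an L-algebraic cuspidal `π` on `GL₄(𝔸_ℚ)` Satake–Frobenius compatible
with `r` a.e. — this IS the `B_w` clause of the summit seam at `(n, F) = (4, ℚ)`. [folklore] -/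
def IsWeaklyModular (p : ℕ) [Fact p.Prime] (r : FramedGaloisRep ℚ (PadicAlgCl p) 4) : Prop :=
  ∀ (hcpt : isCompact_glFiniteIntegralLevel 4 ℚ) (ι : PadicAlgCl p ≃+* ℂ),
    ∃ π : CuspidalAutomorphicRepData 4 ℚ hcpt, π.1.IsLAlgebraic ∧
      ∀ᶠ v : HeightOneSpectrum (𝓞 ℚ) in cofinite, ∃ a : Multiset ℂ,
        π.1.HasSatakeParamAt v a ∧ r.IsUnramifiedAt v ∧
          r.HasFrobCharpolyAt v (arithFrobPolyOfSatake ι v.residueCard 1 a)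

/-- READBACK: the route target is "every H¹-framing of an End-trivial surface is weakly modular".
[folklore] -/
theorem endTrivialSurfacesModular_iff :
    EndTrivialSurfacesModular ↔
      ∀ A, IsEndTrivialSurface A → ∀ (p : ℕ) [Fact p.Prime]
        (b : Module.Basis (Fin 4) ℚ_[p] (A.rationalTateModule p)) (r : FramedGaloisRep ℚ (PadicAlgCl p) 4),
          IsH1Framing A p b r → IsWeaklyModular p r := by
  constructor
  · intro h A hA p _ b r hr hcpt ι
    exact h A hA.1 hA.2 p b r hr hcpt ι
  · intro h A hdim hend p _ b r hr hcpt ι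
    exact h A ⟨hdim, hend⟩ p b r hr hcpt ι

/-- The weak-modularity clause is literally the seam's `B_w` conclusion (`SatakeFrobCompatibleAt`)
for `(n, F) = (4, ℚ)`. [folklore] -/
theorem isWeaklyModular_iff_satakeFrob (p : ℕ) [Fact p.Prime] (r : FramedGaloisRep ℚ (PadicAlgCl p) 4) :
    IsWeaklyModular p r ↔
      ∀ (hcpt : isCompact_glFiniteIntegralLevel 4 ℚ) (ι : PadicAlgCl p ≃+* ℂ),
        ∃ π : CuspidalAutomorphicRepData 4 ℚ hcpt, π.1.IsLAlgebraic ∧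
          ∀ᶠ v : HeightOneSpectrum (𝓞 ℚ) in cofinite, SatakeFrobCompatibleAt ι π.1 r v :=
  Iff.rfl

/-! ## §2 Card `burkhardt-anchor`: X is the missing Langlands–Tunnell of `GSp₄` at `p = 3` -/

/-- `ρ̄ : Γ_ℚ → GL₄(𝔽₃)` preserves a non-degenerate alternating form `J` up to the multiplier `ε̄₃⁻¹`
(the symplectic clause of the sibling crux `SerreGSp4Surjective`, verbatim at `p = 3`, with the
big-image clause DROPPED — the anchor needs no image hypothesis).  NB `ε̄₃` has order `2`, so
`ε̄₃⁻¹ = ε̄₃ = ε̄₃^a` for every odd `a`: the multiplier condition is automatic for the mod-3 reduction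
of ANY paritious odd-similitude symplectic compatible system over `ℚ`. [folklore] -/
def IsSymplecticModThree (ρ : FramedGaloisRep ℚ (ZMod 3) 4) : Prop :=
  ∃ J : Matrix (Fin 4) (Fin 4) (ZMod 3), J.transpose = -J ∧ IsUnit J.det ∧
    ∀ g : Field.absoluteGaloisGroup ℚ,
      (ρ g).val.transpose * J * (ρ g).val =
        (((modPCyclotomicCharacterZMod ℚ 3 g)⁻¹ : (ZMod 3)ˣ) : ZMod 3) • J

/-- **`r : Γ_ℚ → GL₄(ℚ̄₃)` reduces to `ρ̄`**: the characteristic polynomials of `r` are integral and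
reduce, along some `red : 𝒪_{ℚ̄₃} → 𝔽̄₃`, to those of `ρ̄ ⊗ 𝔽̄₃` (the reduction clause of
`SerreGSp4Surjective`, verbatim at `p = 3`; Brauer–Nesbitt form, frame-free). [folklore] -/
def ReducesTo (r : FramedGaloisRep ℚ (PadicAlgCl 3) 4) (ρ : FramedGaloisRep ℚ (ZMod 3) 4) : Prop :=
  ∃ red : (Valued.v : Valuation (PadicAlgCl 3) NNReal).valuationSubring →+* AlgebraicClosure (ZMod 3),
    ∀ g : Field.absoluteGaloisGroup ℚ,
      ∃ P : Polynomial (Valued.v : Valuation (PadicAlgCl 3) NNReal).valuationSubring,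
        P.map (Valued.v : Valuation (PadicAlgCl 3) NNReal).valuationSubring.subtype =
            FramedRep.charpoly r g ∧
          P.map red = (FramedRep.charpoly ρ g).map (algebraMap (ZMod 3) (AlgebraicClosure (ZMod 3)))

/-- **Burkhardt realisation** (Boxer–Calegari–Gee–Pilloni 2021, §10.2, Thm. 10.2.1 with Prop. 10.2.3
and Lemma 10.2.4 — "`P(ρ̄)` is rational"; quoted in BCGP 2025 §1.2 and Def. 9.2.1: "`P(A[3])` is always
rational by [BCGP]"): every `ρ̄ : Γ_ℚ → GSp₄(𝔽₃)` with similitude `ε̄⁻¹` is, Brauer–Nesbitt-dually, the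
3-torsion of infinitely many abelian surfaces `A/ℚ` with `End_ℂ(A) = ℤ` (a fortiori `End_ℚ(A) = ℤ`),
Jacobians of `y² = quintic`; rendered on ONE such `A` through an `H¹`-framing `r` of `(V₃ A)^∨` that
reduces to `ρ̄`.  Printed proof: `P(ρ̄) → B(ρ̄)` is a degree-6 `PSp₄(𝔽₃)`-equivariantly rational cover of
the twisted Burkhardt quartic (Schur multiplier of `PSp₄(𝔽₃)` has order 2, as in Shepherd-Barron–Taylor
1997 for `X(5)`), then Hilbert irreducibility on the `𝒜₂(5)`-cover makes `ρ̄_{A,5} ⊇ Sp₄(𝔽₅)`, whence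
`End_ℂ = ℤ`.  Named-fact SHAPE (to be vendored by a facts worker), used as a hypothesis.
[cite: arXiv:1812.09269, §10.2 Thm. 10.2.1, Prop. 10.2.3, Lemma 10.2.4] -/
def BurkhardtRealisation : Prop :=
  ∀ ρ : FramedGaloisRep ℚ (ZMod 3) 4, IsSymplecticModThree ρ →
    ∃ A : Literature.AlgebraicGeometry.Motives.AbelianVariety ℚ, IsEndTrivialSurface A ∧
      ∃ (b : Module.Basis (Fin 4) ℚ_[3] (A.rationalTateModule 3)) (r : FramedGaloisRep ℚ (PadicAlgCl 3) 4),
        IsH1Framing A 3 b r ∧ ReducesTo r ρ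

/-- **Serre's conjecture mod 3 for `GSp₄/ℚ`, abelian-surface avatar**: every mod-3 symplectic `ρ̄` with
multiplier `ε̄⁻¹` — NO image hypothesis, NO condition at `2` or `3` — is the reduction of a 3-adic
`r : Γ_ℚ → GL₄(ℚ̄₃)` that is weakly modular (L-algebraic cuspidal `π` on `GL₄/ℚ`, Satake–Frobenius
compatible a.e.).  BCGP 2021 §1.1: "there is no argument to reduce the residual modularity of a
surjective mod-3 representation `ρ̄₃ : G_F → GSp₄(𝔽₃)` … to special cases of the Artin conjecture
(proved by Langlands–Tunnell)" — X is that argument. [folklore] -/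
def SerreModThreeGSp4 : Prop :=
  ∀ ρ : FramedGaloisRep ℚ (ZMod 3) 4, IsSymplecticModThree ρ →
    ∃ r : FramedGaloisRep ℚ (PadicAlgCl 3) 4, ReducesTo r ρ ∧ IsWeaklyModular 3 r

/-- **FIRST LEMMA of card `burkhardt-anchor` (PROVED): X ⇒ Serre mod 3 for `GSp₄/ℚ`**, through the
Burkhardt realisation.  Pure plumbing: realise `ρ̄` as `A[3]`, apply X to `A`. [folklore] -/
theorem serreModThree_of_X (hX : EndTrivialSurfacesModular) (hB : BurkhardtRealisation) :
    SerreModThreeGSp4 := by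
  intro ρ hρ
  obtain ⟨A, hA, b, r, hr, hred⟩ := hB ρ hρ
  exact ⟨r, hred, (endTrivialSurfacesModular_iff.mp hX) A hA 3 b r hr⟩

/-- **The anchored region `R_A(X)` (3-adic, weight `(2,2)`, ordinary)** — the `B_w`-instances that X
reaches through the anchor and the printed lifting theorem BCGP 2021 Thm. 8.4.1 (`p = 3` splits in `ℚ`;
`ν ∘ ρ = ε⁻¹`; `ρ̄` vast and tidy — a SURJECTIVE `GSp₄(𝔽₃)` image with this similitude is, BCGP 2021
Lemma 7.5.x (p. 124); `ρ|_{Γ_{ℚ₃}}` 3-distinguished weight-2 ordinary; residually ordinarily modular in weight 2 with a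
PURE comparison representation; `ρ|_{Γ_{ℚ_v}}` pure at every finite `v`): typed here by the tree's
ordinary-shape predicates with `a = (0,0,1,1)` and the SURJECTIVE-image proxy of the sibling crux; the
purity hypotheses of Thm. 8.4.1 at ramified `v ∤ 3` are NOT typed in this sketch (no WD-purity predicate
in the tree yet) and are recorded in the card — this `def` is the SHAPE of the region, not a stub. -/
def InAnchoredRegion (ρ : FramedGaloisRep ℚ (PadicAlgCl 3) 4) : Prop :=
  ρ.toGaloisRep.IsIrreducible ∧
    (∃ ρbar : FramedGaloisRep ℚ (ZMod 3) 4, IsSymplecticModThree ρbar ∧ ReducesTo ρ ρbar ∧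
      ∃ J : Matrix (Fin 4) (Fin 4) (ZMod 3), J.transpose = -J ∧ IsUnit J.det ∧
        ∀ M : GL (Fin 4) (ZMod 3), (∃ c : ZMod 3, IsUnit c ∧ M.val.transpose * J * M.val = c • J) →
          M ∈ ρbar.toMonoidHom.range) ∧
    (∀ᶠ v : HeightOneSpectrum (𝓞 ℚ) in cofinite, ρ.IsUnramifiedAt v) ∧
    ∀ v : HeightOneSpectrum (𝓞 ℚ), ((3 : ℕ) : 𝓞 ℚ) ∈ v.asIdeal →
      ρ.IsCrystallineOrdinaryOfShapeAt v ![0, 0, 1, 1] ∧ ρ.IsResiduallyDistinguishedAt v ![0, 0, 1, 1]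

/-- **The transport the crux-planner would stub** (`B_w` on the anchored region): the composite of
`serreModThree_of_X` (anchor: `ρ̄ ≅ ρ̄_{A,3}` with `A/ℚ` End-trivial, choosable good ordinary at 3 when
`ρ̄|_{Γ_{ℚ₃}}` is locally the 3-torsion of a good ordinary surface — last clause of BCGP 2021
Thm. 10.2.1), Arthur's transfer of `π_A` to `GSp₄` weight `(2,2)` ordinary, and BCGP 2021 Thm. 8.4.1 at
`p = 3`.  Stated as a Prop (the purity caveat of `InAnchoredRegion` applies). -/
def AnchoredRegionModular : Prop :=
  ∀ ρ : FramedGaloisRep ℚ (PadicAlgCl 3) 4, InAnchoredRegion ρ → IsWeaklyModular 3 ρ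

/-! ## §3 Card `weil-restriction-descent`: X exits down the cyclic induction `GL₂/K ⇝ GL₄/ℚ` -/

section Descent

variable {K : Type} [Field K] [NumberField K] {p : ℕ} [Fact p.Prime]

/-- **`ρ` is an a.e. factor of `R`**: at almost every place `w` of `K` both are unramified and the
Frobenius polynomial of `ρ` divides that of `R` — the Chebotarev/Brauer–Nesbitt shadow of
"`ρ` is a constituent of `R^{ss}`"; for `R = (Ind_K^ℚ ρ)|_{Γ_K} = ρ ⊕ ρ^σ` it holds with the
conjugate's polynomial as cofactor. [folklore] -/
def IsFactorAE (R : FramedGaloisRep K (PadicAlgCl p) 4) (ρ : FramedGaloisRep K (PadicAlgCl p) 2) : Prop :=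
  ∀ᶠ w : HeightOneSpectrum (𝓞 K) in cofinite,
    ρ.IsUnramifiedAt w ∧ R.IsUnramifiedAt w ∧
      ∀ P : Polynomial (PadicAlgCl p), ρ.HasFrobCharpolyAt w P →
        ∃ Q : Polynomial (PadicAlgCl p), R.HasFrobCharpolyAt w (P * Q)

variable (K p) in
/-- **The descent region `R_B(X)`** over the quadratic field `K`: rank-2 `ρ : Γ_K → GL₂(ℚ̄_p)` that are
an a.e. factor of the restriction to `Γ_K` of an `H¹`-framing of an End-trivial abelian surface over `ℚ`
(Weil restrictions of non-CM elliptic curves that are not `K`-curves: BCGP type **B[C₂]**; simple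
surfaces acquiring real multiplication over `K`). [folklore] -/
def InDescentRegion (ρ : FramedGaloisRep K (PadicAlgCl p) 2) : Prop :=
  Module.finrank ℚ K = 2 ∧
    ∃ A : Literature.AlgebraicGeometry.Motives.AbelianVariety ℚ, IsEndTrivialSurface A ∧
      ∃ (b : Module.Basis (Fin 4) ℚ_[p] (A.rationalTateModule p)) (r : FramedGaloisRep ℚ (PadicAlgCl p) 4),
        IsH1Framing A p b r ∧ IsFactorAE (r.restrictField K) ρ

variable (K p) in
/-- The `B_w` clause of the summit seam for a rank-2 `ρ` over `K` (verbatim the conclusion shape of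
`GaloisToAutomorphic` minus LGC: an L-algebraic cuspidal `π` on `GL₂(𝔸_K)` Satake–Frobenius compatible
with `ρ` a.e.). [folklore] -/
def WeaklyAutomorphicGL2 (ρ : FramedGaloisRep K (PadicAlgCl p) 2) : Prop :=
  ∀ (hK : isCompact_glFiniteIntegralLevel 2 K) (ι : PadicAlgCl p ≃+* ℂ),
    ∃ π : CuspidalAutomorphicRepData 2 K hK, π.1.IsLAlgebraic ∧
      ∀ᶠ w : HeightOneSpectrum (𝓞 K) in cofinite, SatakeFrobCompatibleAt ι π.1 ρ w

end Descent

/-- **Cyclic de-induction package** (theorem-grade, every ingredient in print; BCGP 2021 §9.3 proof of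
the "genus one curves over quadratic extensions" theorem, run over `ℚ`): for `K/ℚ` quadratic with
character `η`, and `ρ : Γ_K → GL₂(ℚ̄_p)` an a.e. factor of `r|_{Γ_K}` for a WEAKLY MODULAR `H¹`-framing
`r` of an End-trivial surface — (i) `r ≅ Ind_K^ℚ ρ` (Frobenius reciprocity + Chebotarev + Brauer–Nesbitt;
`r` irreducible by Faltings since `End_ℚ A = ℤ`), (ii) the `Π` of X satisfies `Π ≅ Π ⊗ η` (a.e. Satake
self-twist + Jacquet–Shalika / strong multiplicity one), (iii) `Π = AI_K^ℚ(π)` for a cuspidal `π` on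
`GL₂(𝔸_K)`, `π ≇ π^σ` (Arthur–Clozel, Ann. Math. Stud. 120, Ch. 3 Thm. 4.2 (b) + Lemma 6.6 — the
DESCENT half of cyclic automorphic induction; the tree vends only the ascent half
`automorphicInduction_cyclic_cuspidal`), (iv) `π_∞` is cohomological of parallel weight 2 / weight 0 up
to the L-twist (BCGP 2021 Lemma 2.9.1-type archimedean bookkeeping + the "`χ_π = 1`" big-monodromy
argument of their §9.3, here with Serre's open image for `End = ℤ`), (v) `ρ_{π,p}` exists with a.e.
compatibility (real quadratic `K`: Carayol/Taylor/Blasius–Rogawski; imaginary quadratic: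
Harris–Lan–Taylor–Thorne 2016 Thm. A / Scholze 2015, `π` regular algebraic over a CM field), (vi)
`Ind ρ_{π,p} ≅ Ind ρ` ⇒ `ρ_{π,p} ∈ {ρ, ρ^σ}`, swap `π ↔ π^σ`.  Conclusion: the `B_w` clause for `ρ` over `K`.
Named-package SHAPE, hypothesis of the transport below. [cite: arXiv:1812.09269, §9.3]
[cite: ArthurClozelAMS120, Ch. 3 Thm. 4.2 and Lemma 6.6] -/
def CyclicDeinductionPackage : Prop :=
  ∀ (K : Type) [Field K] [NumberField K] (p : ℕ) [Fact p.Prime] (ρ : FramedGaloisRep K (PadicAlgCl p) 2),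
    Module.finrank ℚ K = 2 →
      (∃ A : Literature.AlgebraicGeometry.Motives.AbelianVariety ℚ, IsEndTrivialSurface A ∧
        ∃ (b : Module.Basis (Fin 4) ℚ_[p] (A.rationalTateModule p)) (r : FramedGaloisRep ℚ (PadicAlgCl p) 4),
          IsH1Framing A p b r ∧ IsFactorAE (r.restrictField K) ρ ∧ IsWeaklyModular p r) →
        WeaklyAutomorphicGL2 K p ρ

/-- **REGION THEOREM of card `weil-restriction-descent` (PROVED modulo the package): X ⇒ `B_w` on the
descent region over every quadratic field.**  X supplies the weak modularity of the ambient framing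
`r`; the package de-induces. [folklore] -/
theorem regionB_of_X (hX : EndTrivialSurfacesModular) (hD : CyclicDeinductionPackage)
    (K : Type) [Field K] [NumberField K] (p : ℕ) [Fact p.Prime] (ρ : FramedGaloisRep K (PadicAlgCl p) 2)
    (hρ : InDescentRegion K p ρ) : WeaklyAutomorphicGL2 K p ρ := by
  obtain ⟨hK, A, hA, b, r, hr, hfac⟩ := hρ
  exact hD K p ρ hK ⟨A, hA, b, r, hr, hfac, (endTrivialSurfacesModular_iff.mp hX) A hA p b r hr⟩

/-- **Every elliptic curve over every quadratic field is modular** (Caraiani–Newton's predicate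
`IsModularEllipticCurve`: CM, or a weight-zero cuspidal `π` on `GL₂(𝔸_K)` with `q_w^{1/2}(α_w + β_w) =
a_w(E)` a.e.).  KNOWN for real quadratic `K` (Freitas–Le Hung–Siksek 2015) and for imaginary quadratic
`K` with `X₀(15)(K)` finite (Caraiani–Newton 2023 Thm. 1.1, tree fact `CaraianiNewton2023_modularity`);
OPEN in general for imaginary quadratic `K` (the residue is exactly the open core of the sibling crux
`QuadraticImprimitiveSurfaces`).  Stated with the elliptic instance on the generic fibre. [folklore] -/
def EllipticOverQuadraticModular : Prop :=
  ∀ (K : Type) [Field K] [NumberField K], Module.finrank ℚ K = 2 →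
    ∀ (E : WeierstrassCurve (𝓞 K)) [(E.baseChange K).IsElliptic], IsModularEllipticCurve K E

/-- **Weil-restriction dichotomy** (theorem-grade): for an elliptic curve `E` over a quadratic field `K`
and a prime `p`, EITHER `E` is modular outright — geometric CM (first disjunct of the predicate), or `E`
is a `K`-curve (isogenous over `K̄` to a twist of its Galois conjugate: modular by Ribet 2004 +
Khare–Wintenberger 2009, resp. by base change from `ℚ`) — OR `A := Res_{K/ℚ} E` is an abelian surface
over `ℚ` with `End_ℚ(A) = ℤ` (type **B[C₂]**: `End⁰(A_ℚ̄) = ℚ × ℚ` swapped by `σ`) whose `H¹`-framing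
restricted to `Γ_K` has `H¹(E) = ρ_{E,p}^∨` (`framedTateGaloisRepDual`) as an a.e. factor (Mackey:
`(Ind ρ)|_K = ρ ⊕ ρ^σ`).  Needs the Weil restriction `Res_{K/ℚ}` on the tree's `AbelianVariety ℚ`
(definition request D1 of the card).  Named-package SHAPE. [cite: arXiv:1812.09269, §9.3 (proof of the
genus-one theorem: "set `A = Res_{K/F} E`. Then `A` is an abelian surface of type B[C₂], and
`ℛ_A = Ind_{G_K}^{G_F} ℛ_E`")] -/
def WeilRestrictionDichotomy : Prop :=
  ∀ (K : Type) [Field K] [NumberField K], Module.finrank ℚ K = 2 →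
    ∀ (E : WeierstrassCurve (𝓞 K)) [(E.baseChange K).IsElliptic] (p : ℕ) [Fact p.Prime],
      IsModularEllipticCurve K E ∨
        InDescentRegion K p ((E.baseChange K).framedTateGaloisRepDual p)

/-- **Half-twist bridge** (S-sized bookkeeping, theorem-grade): an L-algebraic cuspidal `π` on `GL₂(𝔸_K)`
Satake–Frobenius compatible a.e. with `ρ_{E,p}^∨ = H¹(E)` (arithmetic Frobenius polynomial
`X² - (a_w/q_w)X + 1/q_w`, `hasFrobCharpolyAt_framedTateGaloisRepDual`) yields, after the twist
`π ⊗ |det|^{1/2}` to weight zero, the predicate `IsModularEllipticCurve K E` (`q_w^{1/2}(α+β) = a_w(E)`);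
the same bridge as `IsHilbertModular.of_isAutomorphicOfWeightZero` / the `eisenstein-entry` card's P3.
Named-package SHAPE. [folklore] -/
def HalfTwistBridge : Prop :=
  ∀ (K : Type) [Field K] [NumberField K] (E : WeierstrassCurve (𝓞 K)) [(E.baseChange K).IsElliptic]
    (p : ℕ) [Fact p.Prime],
      WeaklyAutomorphicGL2 K p ((E.baseChange K).framedTateGaloisRepDual p) → IsModularEllipticCurve K E

/-- **COROLLARY of card `weil-restriction-descent` (PROVED modulo the three packages): X ⇒ every elliptic
curve over every quadratic field — real OR imaginary — is modular.**  In particular X settles the open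
imaginary-quadratic residue of elliptic-curve modularity (all `K` with `X₀(15)(K)` infinite), i.e. the
elliptic half of the open core of the route's own crux `QuadraticImprimitiveSurfaces`, run BACKWARDS
through BCGP's printed reduction. [folklore] -/
theorem ellipticOverQuadratic_of_X (hX : EndTrivialSurfacesModular) (hD : CyclicDeinductionPackage)
    (hW : WeilRestrictionDichotomy) (hH : HalfTwistBridge) : EllipticOverQuadraticModular := by
  intro K _ _ hK E _
  rcases hW K hK E 2 with h | h
  · exact h
  · exact hH K E 2 (regionB_of_X hX hD K 2 _ h)

/-! ## §4 How either card becomes a LINE on `S` (shape only; the leaves are the summit's shared ones)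

`S ⇐ W ∧ B_w^{off R(X)} ∧ LGC_{∀𝓡} ∧ JS (2.2) ∧ JS (2.3)` with `B_w := by_cases (InRegion ρ)`:
on `R(X)` use `AnchoredRegionModular` (card A) / `regionB_of_X` (card B), off it the stub; then the
certified seam `Cruxes/SectorToLanglands/Lines/SectorToLanglandsOfLeaves.lean` re-elaborated with the
`∀ 𝓡` LGC leaf (or the `reciprocity-rigidity` repair `Langlands ↔ Langlands_∃`).  Not typed here (crux-plan
stage); the point of this file is that the two transports ELABORATE and their plumbing is PROVED. -/

/-- Sanity: the anchor theorem composes with the region shape — on the descent region, X alone (plus the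
package) gives the `B_w` clause, so a `by_cases` cut of the `B_w` leaf is well-typed. [folklore] -/
example (hX : EndTrivialSurfacesModular) (hD : CyclicDeinductionPackage)
    (K : Type) [Field K] [NumberField K] (p : ℕ) [Fact p.Prime]
    (off : ∀ ρ : FramedGaloisRep K (PadicAlgCl p) 2, ¬ InDescentRegion K p ρ → WeaklyAutomorphicGL2 K p ρ)
    (ρ : FramedGaloisRep K (PadicAlgCl p) 2) : WeaklyAutomorphicGL2 K p ρ := by
  by_cases h : InDescentRegion K p ρ
  · exact regionB_of_X hX hD K p ρ h
  · exact off ρ h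

end Summit.Langlands.Langlands.Cruxes.SurfaceSectorComplement.IdeasR1K1

end
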